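import Literature.RingTheory.Valuation.AlgClosedResidue
import Literature.NumberTheory.QuadraticFields.SquareRootGenerator
import Mathlib.NumberTheory.Zsqrtd.Basic
import Mathlib.RingTheory.AdjoinRoot
import Mathlib.Algebra.Polynomial.SpecificDegree
import Mathlib.FieldTheory.IsAlgClosed.Basic
import HarnessLib

/-!
# `ℤ[√d] → ℚ(√d) ⊂ F̄`, the conjugation, and a place above a split prime

Topic `NumberTheory/EllipticCurves` (service file for the reduction of complex multiplications,
`ComplexMultiplicationDeuringReductionProofs`; nothing here is specific to elliptic curves, but
the packaging is). For a negative integer `d`: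

* complements on Mathlib's order `ℤ√d` (`Zsqrtd`, with its universal property `Zsqrtd.lift` and
  `Zsqrtd.hom_ext`, used as they are): it is a domain for `d < 0` (`Zsqrtd.isDomain_of_neg`;
  Mathlib only instantiates `IsDomain` for positive non-squares), `√d ^ 2 = d`, `lift r √d = r`;
* `sqrtField d = ℚ[X]/(X² - d) ≅ ℚ(√d)` (Mathlib `AdjoinRoot`, a field under
  `Fact (Irreducible _)`), `r = √d`, the map `Zsqrtd.lift : ℤ√d → ℚ(√d)` (`sqrtField.ofInt`), the
  conjugation `r ↦ -r` obtained from the tree's generic `Quadratic.conj`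
  (`QuadraticFields/SquareRootGenerator`), and an extension `σ̄` of it to an automorphism of the
  algebraic closure `F̄` (`IsAlgClosure.equivOfEquiv`);
* for a prime `p` at which `d` is a square, a **place of `F̄` above `p` together with compatible
  maps** (`SplitPlace`, `exists_splitPlace`): a valuation subring `A ∋ √d` of `F̄` with `p ∈ 𝔪_A`
  (`Literature.RingTheory.Valuation.AlgClosedResidue`), `f_A : ℤ√d → A`, `f₀ : ℤ√d → 𝔽_p`
  (`√d ↦ s₀`, `s₀² = d`), and a ring map `g : AlgebraicClosure (ZMod p) → k_A` onto the residue
  field with `g ∘ f₀ = (reduction) ∘ f_A` — the sign of `s₀` being chosen to match the reduction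
  of `√d`.

All standard (Neukirch, *Algebraic Number Theory*, I §8; Cox, *Primes of the form x² + ny²*,
Prop. 5.16 for the splitting of `p`). [folklore]

## Design

Library fit. The order is Mathlib's `ℤ√d` itself. For the field we use `AdjoinRoot` rather than
Mathlib's `QuadraticAlgebra ℚ d 0` (also a field under a `Fact`) because the consumers need, all
at once, `Field`, `Algebra ℚ`, `CharZero`, `Module.Finite ℚ` (`AdjoinRoot.powerBasis`) and the
`AlgebraicClosure`/`IsAlgClosure.equivOfEquiv` machinery, which are available for `AdjoinRoot`
off the shelf; the conjugation is *not* re-implemented but taken from the tree's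
`Literature.NumberTheory.QuadraticFields.Quadratic.conj` (square-root generator `r`,
`finrank = 2`). Definitions with bodies and theorems; `noncomputable section`. The place is
packaged as a structure `SplitPlace d p` (data + the compatibilities consumed downstream) and
produced by `exists_splitPlace`.
-/

noncomputable section

open Polynomial IsLocalRing

/-! ## Complements on `ℤ√d` -/

namespace Zsqrtd

/-- `ℤ√d` is a domain for `d < 0` (the norm `a² - d b²` vanishes only at `0`; Mathlib's instance
covers positive non-squares). [folklore] -/
theorem isDomain_of_neg {d : ℤ} (hd : d < 0) : IsDomain (ℤ√d) := by
  have hns : ∀ n : ℤ, d ≠ n * n := fun n h ↦ by nlinarith [mul_self_nonneg n]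
  haveI : NoZeroDivisors (ℤ√d) := ⟨fun {a b} h ↦ by
    have hn := congrArg norm h
    rw [norm_mul, norm_zero, mul_eq_zero] at hn
    exact hn.imp (norm_eq_zero hns a).mp (norm_eq_zero hns b).mp⟩
  exact NoZeroDivisors.to_isDomain _

/-- `√d ^ 2 = d` in `ℤ√d`. [folklore] -/
theorem sqrtd_sq (d : ℤ) : (sqrtd : ℤ√d) ^ 2 = (d : ℤ√d) := by
  rw [pow_two, dmuld]

/-- `Zsqrtd.lift r` sends `√d ↦ r`. [folklore] -/
@[simp] theorem lift_sqrtd {R : Type*} [CommRing R] {d : ℤ} (r : {r : R // r * r = ↑d}) :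
    lift r sqrtd = (r : R) := by
  simp [lift_apply_apply, sqrtd]

/-- The element of `{r // r * r = d}` attached to a square root `s` of `d` (`s ^ 2 = d`).
[folklore] -/
def rootOfSq {R : Type*} [CommRing R] {d : ℤ} (s : R) (hs : s ^ 2 = (d : R)) :
    {r : R // r * r = ↑d} :=
  ⟨s, by rw [← pow_two, hs]⟩

end Zsqrtd

namespace Literature.NumberTheory.EllipticCurves

/-! ## `ℚ(√d)` and its conjugation -/

/-- For `d < 0`, `X² - d` is irreducible over `ℚ`. [folklore] -/
theorem irreducible_sqrtPoly_rat {d : ℤ} (hd : d < 0) :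
    Irreducible (X ^ 2 - C (d : ℚ) : ℚ[X]) := by
  have hm : (X ^ 2 - C (d : ℚ) : ℚ[X]).Monic := monic_X_pow_sub_C _ two_ne_zero
  rw [hm.irreducible_iff_roots_eq_zero_of_degree_le_three (by rw [natDegree_X_pow_sub_C])
    (by rw [natDegree_X_pow_sub_C]; norm_num), Multiset.eq_zero_iff_forall_notMem]
  intro r hr
  rw [mem_roots hm.ne_zero, IsRoot.def, eval_sub, eval_pow, eval_X, eval_C, sub_eq_zero] at hr
  have : (0 : ℚ) ≤ d := by rw [← hr]; positivity
  exact absurd (by exact_mod_cast this : (0 : ℤ) ≤ d) (not_le.mpr hd)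

/-- **The field `ℚ(√d) = ℚ[X]/(X² - d)`** (a field for `d < 0`, via the `Fact` instance below;
cf. Mathlib's `QuadraticAlgebra ℚ d 0` for another model). [folklore] -/
abbrev sqrtField (d : ℤ) : Type := AdjoinRoot (X ^ 2 - C (d : ℚ) : ℚ[X])

namespace sqrtField

variable (d : ℤ) [hd : Fact (d < 0)]

/-- The irreducibility instance making `sqrtField d` a field. [folklore] -/
instance fact_irreducible : Fact (Irreducible (X ^ 2 - C (d : ℚ) : ℚ[X])) :=
  ⟨irreducible_sqrtPoly_rat hd.out⟩

/-- `ℚ(√d)` has characteristic `0`. [folklore] -/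
instance charZero : CharZero (sqrtField d) :=
  charZero_of_injective_algebraMap (algebraMap ℚ (sqrtField d)).injective

/-- `[ℚ(√d) : ℚ] = 2`. [folklore] -/
theorem finrank_eq_two : Module.finrank ℚ (sqrtField d) = 2 := by
  change Module.finrank ℚ (ℚ[X] ⧸ Ideal.span {(X ^ 2 - C (d : ℚ) : ℚ[X])}) = 2
  rw [finrank_quotient_span_eq_natDegree, natDegree_X_pow_sub_C]

/-- `ℚ(√d)` is finite over `ℚ`. [folklore] -/
instance moduleFinite : Module.Finite ℚ (sqrtField d) :=
  (AdjoinRoot.powerBasis (irreducible_sqrtPoly_rat hd.out).ne_zero).finite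

/-- `r = √d ∈ ℚ(√d)`. [folklore] -/
def r : sqrtField d := AdjoinRoot.root _

/-- `r² = d`. [folklore] -/
theorem r_sq : r d ^ 2 = algebraMap ℚ (sqrtField d) (d : ℚ) := by
  have h := AdjoinRoot.eval₂_root (X ^ 2 - C (d : ℚ) : ℚ[X])
  rw [eval₂_sub, eval₂_pow, eval₂_X, eval₂_C, sub_eq_zero] at h
  exact h

/-- `r² = d` with an integer cast. [folklore] -/
theorem r_sq' : r d ^ 2 = (d : sqrtField d) := by
  rw [r_sq, map_intCast]

/-- `r ≠ 0` (as `d ≠ 0`). [folklore] -/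
theorem r_ne_zero : r d ≠ 0 := fun h ↦ by
  have := r_sq' d
  rw [h, zero_pow two_ne_zero] at this
  have h0 : (d : sqrtField d) = 0 := this.symm
  exact hd.out.ne (by exact_mod_cast h0)

/-- `√d ∉ ℚ` (a rational square root would make `d ≥ 0`). [folklore] -/
theorem r_not_mem_range : r d ∉ Set.range (algebraMap ℚ (sqrtField d)) := by
  rintro ⟨q, hq⟩
  have h := r_sq d
  rw [← hq, ← map_pow] at h
  have hq2 : q ^ 2 = (d : ℚ) := (algebraMap ℚ (sqrtField d)).injective h
  have : (0 : ℚ) ≤ d := by rw [← hq2]; positivity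
  exact absurd (by exact_mod_cast this : (0 : ℤ) ≤ d) (not_le.mpr hd.out)

/-- The map `ℤ√d → ℚ(√d)`, `√d ↦ r` (`Zsqrtd.lift`). [folklore] -/
def ofInt : ℤ√d →+* sqrtField d := Zsqrtd.lift (Zsqrtd.rootOfSq (r d) (r_sq' d))

/-- `ofInt √d = r`. [folklore] -/
@[simp] theorem ofInt_sqrtd : ofInt d Zsqrtd.sqrtd = r d := Zsqrtd.lift_sqrtd _

/-- **The conjugation `√d ↦ -√d`** of `ℚ(√d)`: the tree's `Quadratic.conj` for the generator `r`.
[folklore] -/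
def conjAlgHom : sqrtField d →ₐ[ℚ] sqrtField d :=
  Literature.NumberTheory.QuadraticFields.Quadratic.conj (finrank_eq_two d) (r_not_mem_range d)
    (r_sq d)

/-- `conj r = -r`. [folklore] -/
@[simp] theorem conjAlgHom_r : conjAlgHom d (r d) = -r d :=
  Literature.NumberTheory.QuadraticFields.Quadratic.conj_gen _ _ _

/-- `conj ∘ conj = id`. [folklore] -/
theorem conjAlgHom_conjAlgHom (x : sqrtField d) : conjAlgHom d (conjAlgHom d x) = x :=
  Literature.NumberTheory.QuadraticFields.Quadratic.conj_conj _ _ _ x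

/-- The conjugation as a ring automorphism. [folklore] -/
def conj : sqrtField d ≃+* sqrtField d :=
  RingEquiv.ofRingHom (conjAlgHom d).toRingHom (conjAlgHom d).toRingHom
    (RingHom.ext (conjAlgHom_conjAlgHom d)) (RingHom.ext (conjAlgHom_conjAlgHom d))

/-- `conj r = -r`. [folklore] -/
@[simp] theorem conj_r : conj d (r d) = -r d := conjAlgHom_r d

/-- **An automorphism `σ̄` of `F̄` extending the conjugation** (`IsAlgClosure.equivOfEquiv`).
[folklore] -/
def conjBar : AlgebraicClosure (sqrtField d) ≃+* AlgebraicClosure (sqrtField d) :=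
  IsAlgClosure.equivOfEquiv (AlgebraicClosure (sqrtField d)) (AlgebraicClosure (sqrtField d)) (conj d)

/-- `σ̄` restricts to the conjugation. [folklore] -/
theorem conjBar_algebraMap (x : sqrtField d) :
    conjBar d (algebraMap (sqrtField d) _ x) = algebraMap (sqrtField d) _ (conj d x) :=
  IsAlgClosure.equivOfEquiv_algebraMap _ _ (conj d) x

/-- `σ̄ (√d) = -√d`. [folklore] -/
theorem conjBar_r : conjBar d (algebraMap (sqrtField d) _ (r d)) = -algebraMap (sqrtField d) _ (r d) := by
  rw [conjBar_algebraMap, conj_r, map_neg]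

/-- `F̄` is algebraic over `ℚ`. [folklore] -/
instance isAlgebraic_rat : Algebra.IsAlgebraic ℚ (AlgebraicClosure (sqrtField d)) := by
  haveI : Algebra.IsAlgebraic ℚ (sqrtField d) := Algebra.IsAlgebraic.of_finite ℚ (sqrtField d)
  exact Algebra.IsAlgebraic.trans ℚ (sqrtField d) (AlgebraicClosure (sqrtField d))

end sqrtField

/-! ## A place of `F̄` above a split prime, with compatible maps -/

/-- **A place of `F̄ = \overline{ℚ(√d)}` above `p` with compatible maps out of `ℤ√d`.** The data:
a valuation subring `A` of `F̄` with `p ∈ 𝔪_A`, containing `√d` (as `uA`); a square root `s₀` of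
`d` in `𝔽_p`; a ring map `g : \overline{𝔽_p} → k_A`; and the compatibility `g(s₀) = \overline{√d}`.
The maps `f_A : ℤ√d → A` (`√d ↦ uA`) and `f₀ : ℤ√d → 𝔽_p` (`√d ↦ s₀`) are then `Zsqrtd.lift`s.
[folklore] -/
structure SplitPlace (d : ℤ) [Fact (d < 0)] (p : ℕ) [Fact p.Prime] where
  /-- The valuation ring of the place. -/
  A : ValuationSubring (AlgebraicClosure (sqrtField d))
  /-- `p ∈ 𝔪_A`. -/
  natCast_mem : ((p : ℕ) : A) ∈ maximalIdeal A
  /-- `√d` as an element of `A`. -/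
  uA : A
  /-- `uA` is `√d`. -/
  coe_uA : (uA : AlgebraicClosure (sqrtField d)) = algebraMap (sqrtField d) _ (sqrtField.r d)
  /-- A square root `s₀` of `d` in `𝔽_p`. -/
  s₀ : ZMod p
  /-- `s₀² = d`. -/
  s₀_sq : s₀ ^ 2 = (d : ZMod p)
  /-- The ring map `\overline{𝔽_p} → k_A`. -/
  g : AlgebraicClosure (ZMod p) →+* ResidueField A
  /-- Compatibility of `g` with the reduction of `√d`: `g(s₀) = \overline{√d}`. -/
  g_s₀ : g (algebraMap (ZMod p) _ s₀) = residue A uA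

namespace SplitPlace

variable {d : ℤ} [Fact (d < 0)] {p : ℕ} [Fact p.Prime] (P : SplitPlace d p)

/-- `uA² = d` in `A`. [folklore] -/
theorem uA_sq : P.uA ^ 2 = (d : P.A) := by
  apply Subtype.ext
  rw [SubmonoidClass.coe_pow, P.coe_uA, ← map_pow, sqrtField.r_sq']
  simp

/-- `f_A : ℤ√d → A`, `√d ↦ uA`. [folklore] -/
def fA : ℤ√d →+* P.A := Zsqrtd.lift (Zsqrtd.rootOfSq P.uA P.uA_sq)

/-- `f_A √d = uA`. [folklore] -/
@[simp] theorem fA_sqrtd : P.fA Zsqrtd.sqrtd = P.uA := Zsqrtd.lift_sqrtd _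

/-- `f₀ : ℤ√d → 𝔽_p`, `√d ↦ s₀`. [folklore] -/
def f₀ : ℤ√d →+* ZMod p := Zsqrtd.lift (Zsqrtd.rootOfSq P.s₀ P.s₀_sq)

/-- `f₀ √d = s₀`. [folklore] -/
@[simp] theorem f₀_sqrtd : P.f₀ Zsqrtd.sqrtd = P.s₀ := Zsqrtd.lift_sqrtd _

/-- **Compatibility with the inclusion into `F̄`**: `(A ⊆ F̄) ∘ f_A = (ℚ(√d) ⊆ F̄) ∘ (ℤ√d → ℚ(√d))`.
[folklore] -/
theorem algebraMap_comp_fA :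
    (algebraMap P.A (AlgebraicClosure (sqrtField d))).comp P.fA =
      (algebraMap (sqrtField d) (AlgebraicClosure (sqrtField d))).comp (sqrtField.ofInt d) := by
  refine Zsqrtd.hom_ext _ _ ?_
  rw [RingHom.comp_apply, RingHom.comp_apply, fA_sqrtd, sqrtField.ofInt_sqrtd]
  exact P.coe_uA

/-- **Compatibility with the residue maps**: `g ∘ (𝔽_p ⊆ \overline{𝔽_p}) ∘ f₀ = red ∘ f_A`.
[folklore] -/
theorem g_comp_f₀ :
    (P.g.comp (algebraMap (ZMod p) (AlgebraicClosure (ZMod p)))).comp P.f₀ =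
      (residue P.A).comp P.fA := by
  refine Zsqrtd.hom_ext _ _ ?_
  rw [RingHom.comp_apply, RingHom.comp_apply, RingHom.comp_apply, f₀_sqrtd, fA_sqrtd]
  exact P.g_s₀

/-- The residue field has characteristic `p`. [folklore] -/
theorem charP : CharP (ResidueField P.A) p :=
  Literature.RingTheory.Valuation.charP_residueField P.A P.natCast_mem

variable (hpd : ¬ (p : ℤ) ∣ d)

include hpd in
/-- `√d` is a unit of `A` (`p ∤ d`). [folklore] -/
theorem isUnit_uA : IsUnit P.uA := by
  haveI := P.charP
  have hd : IsUnit (d : P.A) := by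
    by_contra h
    have hmem : (d : P.A) ∈ maximalIdeal P.A := (IsLocalRing.mem_maximalIdeal _).mpr h
    have h0 := (residue_eq_zero_iff _).mpr hmem
    simp only [map_intCast] at h0
    exact hpd ((CharP.intCast_eq_zero_iff (ResidueField P.A) p d).mp h0)
  rw [← P.uA_sq] at hd
  exact isUnit_of_mul_isUnit_left (by rwa [← pow_two])

include hpd in
/-- `s₀ ≠ 0` (`p ∤ d`). [folklore] -/
theorem s₀_ne_zero : P.s₀ ≠ 0 := fun h ↦ hpd (by
  have := P.s₀_sq
  rw [h, zero_pow two_ne_zero] at this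
  exact (ZMod.intCast_zmod_eq_zero_iff_dvd d p).mp this.symm)

end SplitPlace

/-- **Existence of a split place with compatible maps.** For `d < 0` and a prime `p` with `d` a
square mod `p`: take a valuation subring `A` of `F̄` above `p`
(`exists_valuationSubring_natCast_mem_maximalIdeal`); `√d ∈ A` (it is integral); identify the
residue field with `\overline{𝔽_p}` (`nonempty_residueField_ringEquiv`); the reduction of `√d` is
a square root of `d`, hence `±` the image of a square root `s₁ ∈ 𝔽_p`, which fixes the sign of
`s₀ = ±s₁`. [folklore] -/
theorem exists_splitPlace (d : ℤ) [Fact (d < 0)] (p : ℕ) [Fact p.Prime]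
    (hsq : IsSquare ((d : ℤ) : ZMod p)) : Nonempty (SplitPlace d p) := by
  obtain ⟨A, hpA⟩ := Literature.RingTheory.Valuation.exists_valuationSubring_natCast_mem_maximalIdeal
    (K := AlgebraicClosure (sqrtField d)) (Fact.out : p.Prime)
  -- `√d ∈ A`
  have hint : aeval (algebraMap (sqrtField d) (AlgebraicClosure (sqrtField d)) (sqrtField.r d))
      (X ^ 2 - C (d : A) : A[X]) = 0 := by
    rw [map_sub, map_pow, aeval_X, aeval_C, ← map_pow, sqrtField.r_sq',
      map_intCast (algebraMap (sqrtField d) (AlgebraicClosure (sqrtField d))) d, sub_eq_zero]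
    exact (map_intCast (algebraMap A (AlgebraicClosure (sqrtField d))) d).symm
  obtain ⟨uA, huA⟩ := Literature.RingTheory.Valuation.exists_algebraMap_eq_of_aeval_eq_zero A
    (monic_X_pow_sub_C _ two_ne_zero) hint
  -- residue field
  letI := Literature.RingTheory.Valuation.charP_residueField A hpA
  letI := ZMod.algebra (ResidueField A) p
  obtain ⟨e⟩ := Literature.RingTheory.Valuation.nonempty_residueField_ringEquiv A (p := p) hpA
  -- the reduction of `√d` is `±` the image of a square root of `d` in `𝔽_p`
  obtain ⟨s₁, hs₁⟩ := hsq
  have huA2 : uA ^ 2 = (d : A) := by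
    apply Subtype.ext
    rw [SubmonoidClass.coe_pow, huA, ← map_pow, sqrtField.r_sq']
    simp
  set z := e (residue A uA) with hz
  have hz2 : z ^ 2 = (algebraMap (ZMod p) _ s₁) ^ 2 := by
    have h1 : z ^ 2 = ((d : ℤ) : AlgebraicClosure (ZMod p)) := by
      rw [hz, ← map_pow, ← map_pow, huA2]
      simp only [map_intCast]
    have h2 : (algebraMap (ZMod p) (AlgebraicClosure (ZMod p)) s₁) ^ 2 =
        ((d : ℤ) : AlgebraicClosure (ZMod p)) := by
      rw [← map_pow, pow_two, ← hs₁, map_intCast]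
    rw [h1, h2]
  have hz' : z = algebraMap (ZMod p) _ s₁ ∨ z = algebraMap (ZMod p) _ (-s₁) := by
    rw [map_neg]
    exact eq_or_eq_neg_of_sq_eq_sq _ _ hz2
  -- choose the sign
  obtain ⟨s₀, hs₀2, hs₀⟩ : ∃ s₀ : ZMod p, s₀ ^ 2 = (d : ZMod p) ∧ z = algebraMap (ZMod p) _ s₀ := by
    rcases hz' with h | h
    · exact ⟨s₁, by rw [hs₁, pow_two], h⟩
    · exact ⟨-s₁, by rw [neg_sq, hs₁, pow_two], h⟩
  refine ⟨⟨A, hpA, uA, huA, s₀, hs₀2, (e.symm : _ ≃ₐ[ZMod p] _).toRingHom, ?_⟩⟩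
  change e.symm (algebraMap (ZMod p) _ s₀) = residue A uA
  rw [← hs₀, hz, AlgEquiv.symm_apply_apply]

end Literature.NumberTheory.EllipticCurves
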